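import Mathlib
import HarnessLib

/-!
# ValiantsHypothesis / LacunarySymmetroid — crux `MatrixDescartes` (stmt-ValiantsHypothesis-18050, V1), LINE (A) «product_plus_one»:
# the three ring identities of the TIE-LAW proof (pen val-idea-25 g8, NOTE §45 (I1)–(I3)), kernel-checked in abstract form

With `g(ζ) = γ ζ^c + ζ^a − β`, `c = a + b`, and `ω` any element of a commutative ring with `ω^c = −1`, `ω·ω⁻ = 1`
(over `ℂ`: `ω = exp(iπ/c)`), resp. `ε` with `ε^c = 1`, `ε·ε⁻ = 1` (over `ℂ`: `ε = ω²`):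
* `I1`: `g(ωx)·g(ω⁻x) = m² − (ω^a + ω⁻^a)·x^a·m + x^{2a}`, `m = β + γx^c` — i.e. `q = |g(ωx)|²` on the tie ray;
* `I2`: `(ω^a − ω⁻^a)·x^a·(bγx^c − aβ) = (ωx)g′(ωx)·g(ω⁻x) − (ω⁻x)g′(ω⁻x)·g(ωx)` — i.e. `2i sin(πa/c)·x^a·n = 2i·Im(ζ g′(ζ) \overline{g(ζ)})`;
* `I3` (ray lemma): `(εt)g′(εt)·g(ε⁻t) − (ε⁻t)g′(ε⁻t)·g(εt) = −(ε^a − ε⁻^a)·t^a·(bγt^c + aβ)` — i.e. on the partner ray `arg ζ = 2π/c`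
  every well's `Im(ζ g′ ḡ) = −sin(2πa/c) t^a (bγt^c + aβ) < 0`, the one-signedness that keeps zeros of `M_T` off `∂{|arg x| < π/c}`.
Each is a one-line `linear_combination`.  Exact companions: `pub/val-lit/lmr/staged/p3g22-tiecell/eng/tielaw_identities.py` (the same
identities in `ℤ[ω]/Φ_{2c}` for eight shapes).  HONEST FRAMING: algebraic helper identities; the tie law itself is a PAPER theorem (its
analytic half — continuity of roots on a sector–annulus and the exit step — is not formalised here); no stub of LINE (A) is touched;
`MatrixDescartes` OPEN; `VP ≠ VNP` is NOT proved.  No definitions, no named facts.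
-/

set_option linter.dupNamespace false

namespace Summit.ValiantsHypothesis.ValiantsHypothesis.Theorems.LacunarySymmetroidMatrixDescartes

namespace TieLaw

/-- **(I1)** `g(ωx)·g(ω⁻x) = m² − (ω^a + ω⁻^a) x^a m + x^{2a}` for `g(ζ) = γ ζ^c + ζ^a − β`, `m = β + γ x^c`,
whenever `ω^c = −1` and `ω ω⁻ = 1`. -/
theorem I1 {R : Type*} [CommRing R] (ω ωi β γ x : R) (a c : ℕ)
    (hω : ω ^ c = -1) (hinv : ω * ωi = 1) :
    (γ * (ω * x) ^ c + (ω * x) ^ a - β) * (γ * (ωi * x) ^ c + (ωi * x) ^ a - β)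
      = (β + γ * x ^ c) ^ 2 - (ω ^ a + ωi ^ a) * x ^ a * (β + γ * x ^ c) + x ^ (2 * a) := by
  have hi : ωi ^ c = -1 := by
    have h1 : ω ^ c * ωi ^ c = 1 := by rw [← mul_pow, hinv, one_pow]
    rw [hω] at h1
    linear_combination -h1
  have hP : ω ^ a * ωi ^ a = 1 := by rw [← mul_pow, hinv, one_pow]
  linear_combination (γ ^ 2 * x ^ (2 * c) * ωi ^ c + γ * x ^ c * x ^ a * ωi ^ a - β * γ * x ^ c) * hω
    + (-(γ ^ 2 * x ^ (2 * c)) + γ * x ^ c * x ^ a * ω ^ a - β * γ * x ^ c) * hi + x ^ (2 * a) * hP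

/-- **(I2)** `(ω^a − ω⁻^a)·x^a·(bγx^c − aβ) = (ωx)g′(ωx)·g(ω⁻x) − (ω⁻x)g′(ω⁻x)·g(ωx)` with `ζ g′(ζ) = cγζ^c + aζ^a`,
`c = a + b`, whenever `ω^c = −1`, `ω ω⁻ = 1`. -/
theorem I2 {R : Type*} [CommRing R] (ω ωi β γ x : R) (a b c : ℕ) (hc : c = a + b)
    (hω : ω ^ c = -1) (hinv : ω * ωi = 1) :
    (ω ^ a - ωi ^ a) * x ^ a * ((b : R) * γ * x ^ c - (a : R) * β)
      = ((c : R) * γ * (ω * x) ^ c + (a : R) * (ω * x) ^ a) * (γ * (ωi * x) ^ c + (ωi * x) ^ a - β)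
        - ((c : R) * γ * (ωi * x) ^ c + (a : R) * (ωi * x) ^ a) * (γ * (ω * x) ^ c + (ω * x) ^ a - β) := by
  have hi : ωi ^ c = -1 := by
    have h1 : ω ^ c * ωi ^ c = 1 := by rw [← mul_pow, hinv, one_pow]
    rw [hω] at h1
    linear_combination -h1
  subst hc
  push_cast
  linear_combination
    (-((b : R) * γ * x ^ (a + b) * x ^ a * ωi ^ a) + ((a : R) + (b : R)) * γ * β * x ^ (a + b)) * hω
    + ((b : R) * γ * x ^ (a + b) * x ^ a * ω ^ a - ((a : R) + (b : R)) * γ * β * x ^ (a + b)) * hi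

/-- **(I3)** (ray lemma) `(εt)g′(εt)·g(ε⁻t) − (ε⁻t)g′(ε⁻t)·g(εt) = −(ε^a − ε⁻^a)·t^a·(bγt^c + aβ)` with `ζ g′(ζ) = cγζ^c + aζ^a`,
`c = a + b`, whenever `ε^c = 1`, `ε ε⁻ = 1` (over `ℂ` with `t` real the left side is `2i·Im(ζ g′(ζ) \overline{g(ζ)})` at `ζ = εt`
and `ε^a − ε⁻^a = 2i sin(2πa/c)`). -/
theorem I3 {R : Type*} [CommRing R] (ε εi β γ t : R) (a b c : ℕ) (hc : c = a + b)
    (hε : ε ^ c = 1) (hinv : ε * εi = 1) :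
    ((c : R) * γ * (ε * t) ^ c + (a : R) * (ε * t) ^ a) * (γ * (εi * t) ^ c + (εi * t) ^ a - β)
      - ((c : R) * γ * (εi * t) ^ c + (a : R) * (εi * t) ^ a) * (γ * (ε * t) ^ c + (ε * t) ^ a - β)
      = -((ε ^ a - εi ^ a) * t ^ a * ((b : R) * γ * t ^ c + (a : R) * β)) := by
  have hi : εi ^ c = 1 := by
    have h1 : ε ^ c * εi ^ c = 1 := by rw [← mul_pow, hinv, one_pow]
    rw [hε, one_mul] at h1
    exact h1
  subst hc
  push_cast
  linear_combination
    ((b : R) * γ * t ^ (a + b) * t ^ a * εi ^ a - ((a : R) + (b : R)) * γ * β * t ^ (a + b)) * hε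
    + (-((b : R) * γ * t ^ (a + b) * t ^ a * ε ^ a) + ((a : R) + (b : R)) * γ * β * t ^ (a + b)) * hi

end TieLaw

end Summit.ValiantsHypothesis.ValiantsHypothesis.Theorems.LacunarySymmetroidMatrixDescartes
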